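import Literature.AlgebraicGeometry.HodgeTheory.AlgebraicClassesCupDivisorHolds
import Literature.AlgebraicGeometry.HodgeTheory.HardLefschetzNFoldOfPolarizationClass
import HarnessLib

/-!
# Every polarisation class carries the hard Lefschetz datum: André's `*_L` preserves rational classes and Hodge types

Family `hodge`, layer `Literature/AlgebraicGeometry/HodgeTheory`. In `MotivatedClasses` a
**polarisation class** of a smooth projective complex `n`-fold `X` (Y. André, *Pour une théorie
inconditionnelle des motifs*, Publ. Math. IHÉS 83 (1996), §1.1: "la classe `η = c₁(𝓛_X) ∈ H²(X)` d'un
faisceau inversible ample") is rendered by its three properties `IsPolarizationClass n X η`: rational,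
supported on a divisor (`η ∈ N¹ H²`), hard Lefschetz in dimension `n`. The tree's richer structure
`HardLefschetzNFold n X` (C. Voisin, *Hodge Theory and Complex Algebraic Geometry I*, Thm. 6.25,
Rem. 6.27, §7.1.2: `Lʲ` bijective, defined over `ℚ`, of bidegree `(j, j)`; and
`L(Nˡ H²ˡ) ⊆ Nˡ⁺¹ H²ˡ⁺²`) was so far available for the hyperplane class of a projective embedding
(`nonempty_hardLefschetzNFold_holds`) and, for a general polarisation class, only GRANTED the two
inputs `hLalg` (its Lefschetz operator preserves algebraic classes) and `hη11` (it raises Hodge types by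
`(1,1)`) of `exists_hardLefschetzNFold_of_isPolarizationClass` (`HardLefschetzNFoldOfPolarizationClass`).
Both inputs are now theorems for EVERY class of `N¹ H²`: `hLalg` is the divisor case of Voisin II
Prop. 9.20 on the coniveau carrier (`lefschetzOperator_mem_algebraicClasses_of_mem`,
`AlgebraicClassesCupDivisorHolds`; also, by the printed mechanism "the divisor moves", the summit-side
crux stub `stub_cupProductAlgebraicDivisor` over `ker_restrictCompl_le_of_mem_primeDivisor`), and `hη11`
follows from "algebraic classes are Hodge classes" (`isOfHodgeType_of_mem_algebraicClasses_of_isSmoothProjective`)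
and "`∪` respects the bigrading" (`cupPreservesHodgeType_of_multiplicative_deRham` with de Rham's
theorem). Hence:

* `IsPolarizationClass.exists_hardLefschetzNFold` — **every polarisation class `η` is
  `Λ.hyperplaneClass` for some `Λ : HardLefschetzNFold n X`**, unconditionally;
* `IsPolarizationClass.isRationalClass_lefschetzInvolution_iff_of_le`,
  `…_isRationalClass_lefschetzInvolution_iff_of_ge` — André's Lefschetz involution `*_L`
  (`lefschetzInvolution`, §0.2: "donnée en chaque degré par l'isomorphisme de Lefschetz ou son
  inverse") maps rational classes to rational classes and only those, below and above the middle;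
* `IsPolarizationClass.isOfHodgeType_lefschetzInvolution_iff_of_le`,
  `…_isOfHodgeType_lefschetzInvolution_iff_of_ge` — and shifts Hodge types by `(j, j)`, resp.
  `(−j, −j)`: in particular `*_L` of a rational `(b, b)`-class (e.g. an algebraic class) is a rational
  `(b', b')`-class — the Hodge-theoretic half of "`*_L β` is algebraic" in André's generators
  `pr_{X*}(α ∪ *_L β)` (the other half being conjecture `A`/`B`).

Theorems only; no definition, no named fact (D-0026).

## References

* [Andre1996Motifs] Y. André, Publ. Math. IHÉS 83 (1996): §0.2 (p. 7), §1.1 (p. 10).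
* [VoisinHodgeI2002] C. Voisin, Hodge Theory and Complex Algebraic Geometry I (CUP 2002), Thm. 6.25,
  Rem. 6.27, §7.1.2.
* [VoisinHodgeII2003] C. Voisin, Hodge Theory and Complex Algebraic Geometry II (CUP 2003), §9.2.3
  Lemma 9.18 (proof), §9.2.4 Prop. 9.20.
-/

noncomputable section

open CategoryTheory
open Literature.AlgebraicTopology.SingularHomology Literature.Geometry.Kaehler

namespace Literature.AlgebraicGeometry.HodgeTheory

section HodgeTheory

variable {n : ℕ} {X : Motives.SchemeOver ℂ} {η : complexBetti X 2}

/-- **Every polarisation class carries the hard Lefschetz datum**: for `X` smooth projective of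
dimension `n` over `ℂ` and `η` a polarisation class (`IsPolarizationClass n X η`), there is
`Λ : HardLefschetzNFold n X` with `Λ.hyperplaneClass = η` — the tree's
`exists_hardLefschetzNFold_of_isPolarizationClass` with its two inputs discharged: `L_η` preserves
algebraic classes (the divisor case of Voisin II Prop. 9.20, `lefschetzOperator_mem_algebraicClasses_of_mem`,
since `η ∈ N¹ H²`) and raises Hodge types by `(1, 1)` (`η` is algebraic, hence of type `(1,1)`, and `∪`
respects the bigrading). [cite: VoisinHodgeI2002, Thm. 6.25, Rem. 6.27 and §7.1.2]
[cite: Andre1996Motifs, §1.1 (p. 10)] [cite: VoisinHodgeII2003, §9.2.4 Prop. 9.20] -/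
theorem IsPolarizationClass.exists_hardLefschetzNFold (hX : Motives.IsSmoothProjective n X)
    (hη : IsPolarizationClass n X η) : ∃ Λ : HardLefschetzNFold n X, Λ.hyperplaneClass = η :=
  exists_hardLefschetzNFold_of_isPolarizationClass hX hη
    (fun l _ hc ↦ lefschetzOperator_mem_algebraicClasses_of_mem hX hη.mem_algebraicClasses l hc)
    (isOfHodgeType_lefschetzOperator_of_cupPreservesHodgeType
      (cupPreservesHodgeType_of_multiplicative_deRham
        (fun E _ _ _ ↦ Literature.NumberTheory.Transcendental.exists_deRhamIsoFamily_holds E) hX)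
      (isOfHodgeType_of_mem_algebraicClasses_of_isSmoothProjective hX 1 hη.mem_algebraicClasses))

/-! ### André's Lefschetz involution of a polarisation class: rationality and Hodge types -/

/-- **Below the middle, `*_L = Lʲ` preserves and reflects rationality**: for `a + j = n` and
`x ∈ Hᵃ(X(ℂ); ℂ)`, `*_L x ∈ H^{a+2j}` is rational iff `x` is (`Lʲ : Hᵃ(X, ℚ) ≅ H²ⁿ⁻ᵃ(X, ℚ)`, Voisin I
§7.1.2 with Thm. 6.25). [cite: VoisinHodgeI2002, Thm. 6.25 and §7.1.2] [cite: Andre1996Motifs, §0.2 (p. 7)] -/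
theorem IsPolarizationClass.isRationalClass_lefschetzInvolution_iff_of_le
    (hX : Motives.IsSmoothProjective n X) (hη : IsPolarizationClass n X η) {a j : ℕ} (hj : a + j = n)
    (hab : a + (a + 2 * j) = 2 * n) (x : complexBetti X a) :
    IsRationalClass (lefschetzInvolution hη.hasHardLefschetz hab x) ↔ IsRationalClass x := by
  obtain ⟨Λ, hΛ⟩ := hη.exists_hardLefschetzNFold hX
  subst hΛ
  rw [lefschetzInvolution_apply_of_le hη.hasHardLefschetz hj hab x]
  exact Λ.isRationalClass_L_iff hj (a + 2 * j) rfl x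

/-- **Above the middle, `*_L = (Lʲ)⁻¹` preserves and reflects rationality**: for `b + j = n` and
`y ∈ H^{b+2j}(X(ℂ); ℂ)`, `*_L y ∈ Hᵇ` is rational iff `y` is. [cite: VoisinHodgeI2002, Thm. 6.25 and §7.1.2]
[cite: Andre1996Motifs, §0.2 (p. 7)] -/
theorem IsPolarizationClass.isRationalClass_lefschetzInvolution_iff_of_ge
    (hX : Motives.IsSmoothProjective n X) (hη : IsPolarizationClass n X η) {b j : ℕ} (hj : b + j = n)
    (hab : b + 2 * j + b = 2 * n) (y : complexBetti X (b + 2 * j)) :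
    IsRationalClass (lefschetzInvolution hη.hasHardLefschetz hab y) ↔ IsRationalClass y := by
  obtain ⟨Λ, hΛ⟩ := hη.exists_hardLefschetzNFold hX
  subst hΛ
  conv_rhs => rw [← lefschetzPow_lefschetzInvolution hη.hasHardLefschetz hj hab y]
  exact (Λ.isRationalClass_L_iff hj (b + 2 * j) rfl _).symm

/-- **Below the middle, `*_L = Lʲ` shifts Hodge types by `(j, j)` and reflects them**: for
`a + j = n`, `x` is of type `(p, q)` iff `*_L x` is of type `(p + j, q + j)` (`L` is of bidegree `(1,1)`,
Voisin I Rem. 6.27, and `Lʲ` is bijective, Thm. 6.25). [cite: VoisinHodgeI2002, Thm. 6.25 and Rem. 6.27]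
[cite: Andre1996Motifs, §0.2 (p. 7)] -/
theorem IsPolarizationClass.isOfHodgeType_lefschetzInvolution_iff_of_le
    (hX : Motives.IsSmoothProjective n X) (hη : IsPolarizationClass n X η) {a j : ℕ} (hj : a + j = n)
    (hab : a + (a + 2 * j) = 2 * n) (p q : ℕ) (x : complexBetti X a) :
    IsOfHodgeType n X (a + 2 * j) (p + j) (q + j) (lefschetzInvolution hη.hasHardLefschetz hab x) ↔
      IsOfHodgeType n X a p q x := by
  obtain ⟨Λ, hΛ⟩ := hη.exists_hardLefschetzNFold hX
  subst hΛ
  rw [lefschetzInvolution_apply_of_le hη.hasHardLefschetz hj hab x]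
  exact Λ.isOfHodgeType_L_iff hj (a + 2 * j) rfl p q x

/-- **Above the middle, `*_L = (Lʲ)⁻¹` shifts Hodge types by `(−j, −j)`**: for `b + j = n` and
`y ∈ H^{b+2j}(X(ℂ); ℂ)`, `*_L y ∈ Hᵇ` is of type `(p, q)` iff `y` is of type `(p + j, q + j)`. In
particular `*_L` of a rational `(b', b')`-class of degree `2b' > n` (e.g. an algebraic class) is a
rational `(b' − j, b' − j)`-class. [cite: VoisinHodgeI2002, Thm. 6.25 and Rem. 6.27] [cite: Andre1996Motifs, §0.2 (p. 7)] -/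
theorem IsPolarizationClass.isOfHodgeType_lefschetzInvolution_iff_of_ge
    (hX : Motives.IsSmoothProjective n X) (hη : IsPolarizationClass n X η) {b j : ℕ} (hj : b + j = n)
    (hab : b + 2 * j + b = 2 * n) (p q : ℕ) (y : complexBetti X (b + 2 * j)) :
    IsOfHodgeType n X b p q (lefschetzInvolution hη.hasHardLefschetz hab y) ↔
      IsOfHodgeType n X (b + 2 * j) (p + j) (q + j) y := by
  obtain ⟨Λ, hΛ⟩ := hη.exists_hardLefschetzNFold hX
  subst hΛ
  conv_rhs => rw [← lefschetzPow_lefschetzInvolution hη.hasHardLefschetz hj hab y]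
  exact (Λ.isOfHodgeType_L_iff hj (b + 2 * j) rfl p q _).symm

end HodgeTheory

end Literature.AlgebraicGeometry.HodgeTheory

end
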